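import Summits.Ventures.PercRepro.ProfilePointedCircuitClassesInOutFreeII

/-!
# PercRepro — THE SINGLE-TRIANGLE CASE OF `InOutBottomFour`, III: THE UNIT SIDE OF THE SPLIT (p5, gen 38;
`proofs/P5-GM1.md` §54 ADDENDUM 2 (1))

With `H := E − e`, `H₀ := E − e − f − g` (`e ∈ cl{f, g}` a triangle; every independent `(ρ − 2)`-subset of `H` whose
closure contains `e` contains `f` and `g`): the `5`-subsets `W′` of `H` with `W′ ∈ ℐ`, `H − W′ ∈ ℐ`, `W′ ∩ {f, g} ≠ ∅`
are bi-independent `5`-sets of `N` avoiding `e` (`card_units_le_outCount_five_of_triangle`), and they contain the three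
disjoint families `U_{fg} = {Y ⊆ H₀ : #Y = 3, Y + f + g ∈ ℐ, H₀ − Y ∈ ℐ}`, `U_f = {Y ⊆ H₀ : #Y = 4, Y + f ∈ ℐ,
(H₀ − Y) + g ∈ ℐ}`, `U_g` (`card_units_ge_of_triangle`), so `#U_{fg} + #U_f + #U_g ≤ out_5(e)`.  The demand side is
ProfilePointedCircuitClassesInOutTriangleII.
-/

open scoped Matroid

namespace PercRepro.Cogirth

open Finset ThmH Skew Shadow Profile

variable {α : Type} [DecidableEq α] {N : Matroid α} [N.Finite]

section TriangleUnits

/-- The `5`-subsets `W′` of `E − e` with `W′ ∈ ℐ`, `(E − e) − W′ ∈ ℐ` and `W′ ∩ {f, g} ≠ ∅` are bi-independent `5`-sets of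
`N` avoiding `e`, when every independent `(ρ − 2)`-subset of `E − e` capturing `e` contains `f` and `g`. -/
theorem card_units_le_outCount_five_of_triangle (hn : (gr N).card = rk N (gr N) + 4) {e f g : α} (he : e ∈ gr N)
    (honly : ∀ X ⊆ (gr N).erase e, X.card + 2 = rk N (gr N) → rk N X = X.card → e ∈ clF N X → f ∈ X ∧ g ∈ X) :
    ((((gr N).erase e).powersetCard 5).filter (fun W => rk N W = 5 ∧
      rk N ((gr N).erase e \ W) = ((gr N).erase e \ W).card ∧ (f ∈ W ∨ g ∈ W))).card ≤ outCount N 5 e := by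
  unfold outCount
  apply card_le_card_of_injOn (fun W => W)
  · intro W hW
    rw [mem_coe, mem_filter, mem_powersetCard] at hW
    obtain ⟨⟨hWH, hW5⟩, hWrk, hWc, hWfg⟩ := hW
    have hWg : W ⊆ gr N := hWH.trans (erase_subset _ _)
    have heW : e ∉ W := fun h => (mem_erase.1 (hWH h)).1 rfl
    have hX : (gr N).erase e \ W ⊆ (gr N).erase e := sdiff_subset
    have heX : e ∉ (gr N).erase e \ W := fun h => (mem_erase.1 (mem_sdiff.1 h).1).1 rfl
    have h5 : 5 ≤ ((gr N).erase e).card := by rw [← hW5]; exact card_le_card hWH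
    have hXcard : ((gr N).erase e \ W).card + 2 = rk N (gr N) := by
      rw [card_sdiff_of_subset hWH, card_erase_of_mem he, hW5]
      rw [card_erase_of_mem he] at h5
      omega
    have hecl : e ∉ clF N ((gr N).erase e \ W) := by
      intro hcl
      obtain ⟨hfX, _⟩ := honly _ hX hXcard hWc hcl
      rw [mem_sdiff] at hfX
      rcases hWfg with h | h
      · exact hfX.2 h
      · obtain ⟨_, hgX⟩ := honly _ hX hXcard hWc hcl
        exact (mem_sdiff.1 hgX).2 h
    show W ∈ (biIndepSets N 5).filter (fun X => e ∉ X)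
    rw [mem_filter, mem_biIndepSets]
    refine ⟨⟨hWg, hW5, by rw [hWrk, hW5], ?_⟩, heW⟩
    have e1 : gr N \ W = insert e ((gr N).erase e \ W) := by
      ext a
      simp only [mem_sdiff, mem_insert, mem_erase]
      constructor
      · rintro ⟨hag, haW⟩
        by_cases hae : a = e
        · exact Or.inl hae
        · exact Or.inr ⟨⟨hae, hag⟩, haW⟩
      · rintro (rfl | ⟨⟨_, hag⟩, haW⟩)
        · exact ⟨he, heW⟩
        · exact ⟨hag, haW⟩
    rw [e1, rk_insert_eq he (hX.trans (erase_subset _ _)), if_neg hecl, hWc, card_insert_of_notMem heX]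
  · intro W _ W' _ h
    exact h

/-- The units contain the three disjoint families `U_{fg}`, `U_f`, `U_g` on `H₀ := E − e − f − g`:
`#U_{fg} + #U_f + #U_g ≤ #{W′ ⊆ E − e : #W′ = 5, W′ ∈ ℐ, (E − e) − W′ ∈ ℐ, W′ ∩ {f, g} ≠ ∅}`. -/
theorem card_units_ge_of_triangle {e f g : α} (hf : f ∈ (gr N).erase e) (hg : g ∈ (gr N).erase e) (hfg : f ≠ g) :
    ((((((gr N).erase e).erase f).erase g).powersetCard 3).filter (fun Y => rk N (Y ∪ {f, g}) = 5 ∧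
      rk N ((((gr N).erase e).erase f).erase g \ Y) = ((((gr N).erase e).erase f).erase g \ Y).card)).card +
    ((((((gr N).erase e).erase f).erase g).powersetCard 4).filter (fun Y => rk N (insert f Y) = 5 ∧
      rk N (insert g ((((gr N).erase e).erase f).erase g \ Y)) = (insert g ((((gr N).erase e).erase f).erase g \ Y)).card)).card +
    ((((((gr N).erase e).erase f).erase g).powersetCard 4).filter (fun Y => rk N (insert g Y) = 5 ∧
      rk N (insert f ((((gr N).erase e).erase f).erase g \ Y)) = (insert f ((((gr N).erase e).erase f).erase g \ Y)).card)).card ≤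
    ((((gr N).erase e).powersetCard 5).filter (fun W => rk N W = 5 ∧
      rk N ((gr N).erase e \ W) = ((gr N).erase e \ W).card ∧ (f ∈ W ∨ g ∈ W))).card := by
  obtain ⟨H, hH⟩ : ∃ H : Finset α, H = (gr N).erase e := ⟨_, rfl⟩
  obtain ⟨H₀, hH₀⟩ : ∃ H₀ : Finset α, H₀ = (H.erase f).erase g := ⟨_, rfl⟩
  rw [← hH] at hf hg ⊢
  rw [← hH₀]
  have hH₀H : H₀ ⊆ H := by rw [hH₀]; exact (erase_subset _ _).trans (erase_subset _ _)
  have hfH₀ : f ∉ H₀ := by rw [hH₀]; intro h; exact (mem_erase.1 (erase_subset _ _ h)).1 rfl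
  have hgH₀ : g ∉ H₀ := by rw [hH₀]; intro h; exact (mem_erase.1 h).1 rfl
  have hmemH₀ : ∀ a, a ∈ H₀ ↔ a ∈ H ∧ a ≠ f ∧ a ≠ g := by
    intro a; rw [hH₀]; simp only [mem_erase]; tauto
  obtain ⟨Uall, hUall⟩ : ∃ Uall : Finset (Finset α), Uall = (H.powersetCard 5).filter (fun W => rk N W = 5 ∧
      rk N (H \ W) = (H \ W).card ∧ (f ∈ W ∨ g ∈ W)) := ⟨_, rfl⟩
  rw [← hUall]
  -- the three images
  obtain ⟨A, hA⟩ : ∃ A : Finset (Finset α), A = (H₀.powersetCard 3).filter (fun Y => rk N (Y ∪ {f, g}) = 5 ∧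
      rk N (H₀ \ Y) = (H₀ \ Y).card) := ⟨_, rfl⟩
  obtain ⟨B, hB⟩ : ∃ B : Finset (Finset α), B = (H₀.powersetCard 4).filter (fun Y => rk N (insert f Y) = 5 ∧
      rk N (insert g (H₀ \ Y)) = (insert g (H₀ \ Y)).card) := ⟨_, rfl⟩
  obtain ⟨C, hC⟩ : ∃ C : Finset (Finset α), C = (H₀.powersetCard 4).filter (fun Y => rk N (insert g Y) = 5 ∧
      rk N (insert f (H₀ \ Y)) = (insert f (H₀ \ Y)).card) := ⟨_, rfl⟩
  rw [← hA, ← hB, ← hC]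
  have hAimg : A.image (fun Y => Y ∪ {f, g}) ⊆ Uall.filter (fun W => f ∈ W ∧ g ∈ W) := by
    intro W hW
    rw [mem_image] at hW
    obtain ⟨Y, hY, rfl⟩ := hW
    rw [hA, mem_filter, mem_powersetCard] at hY
    obtain ⟨⟨hYH₀, hY3⟩, hYrk, hYc⟩ := hY
    have hfY : f ∉ Y := fun h => hfH₀ (hYH₀ h)
    have hgY : g ∉ Y := fun h => hgH₀ (hYH₀ h)
    have e1 : H \ (Y ∪ {f, g}) = H₀ \ Y := by
      ext a
      simp only [mem_sdiff, mem_union, mem_insert, mem_singleton, hmemH₀, not_or]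
      tauto
    rw [mem_filter, hUall, mem_filter, mem_powersetCard]
    refine ⟨⟨⟨union_subset (hYH₀.trans hH₀H) (insert_subset hf (singleton_subset_iff.2 hg)), ?_⟩, hYrk, ?_, Or.inl (mem_union_right _ (mem_insert_self _ _))⟩,
      mem_union_right _ (mem_insert_self _ _), mem_union_right _ (mem_insert_of_mem (mem_singleton_self _))⟩
    · rw [card_union_of_disjoint (disjoint_left.2 (fun a ha h => by
        rw [mem_insert, mem_singleton] at h
        rcases h with rfl | rfl
        · exact hfY ha
        · exact hgY ha)), hY3, card_pair hfg]
    · rw [e1]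
      exact hYc
  have hBimg : B.image (fun Y => insert f Y) ⊆ Uall.filter (fun W => f ∈ W ∧ g ∉ W) := by
    intro W hW
    rw [mem_image] at hW
    obtain ⟨Y, hY, rfl⟩ := hW
    rw [hB, mem_filter, mem_powersetCard] at hY
    obtain ⟨⟨hYH₀, hY4⟩, hYrk, hYc⟩ := hY
    have hfY : f ∉ Y := fun h => hfH₀ (hYH₀ h)
    have hgY : g ∉ Y := fun h => hgH₀ (hYH₀ h)
    have e1 : H \ insert f Y = insert g (H₀ \ Y) := by
      ext a
      simp only [mem_sdiff, mem_insert, hmemH₀, not_or]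
      constructor
      · rintro ⟨haH, haf, haY⟩
        by_cases hag : a = g
        · exact Or.inl hag
        · exact Or.inr ⟨⟨haH, haf, hag⟩, haY⟩
      · rintro (rfl | ⟨⟨haH, haf, _⟩, haY⟩)
        · exact ⟨hg, hfg.symm, hgY⟩
        · exact ⟨haH, haf, haY⟩
    rw [mem_filter, hUall, mem_filter, mem_powersetCard]
    refine ⟨⟨⟨insert_subset hf (hYH₀.trans hH₀H), by rw [card_insert_of_notMem hfY, hY4]⟩, hYrk, ?_, Or.inl (mem_insert_self _ _)⟩,
      mem_insert_self _ _, ?_⟩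
    · rw [e1]
      exact hYc
    · rw [mem_insert, not_or]
      exact ⟨hfg.symm, hgY⟩
  have hCimg : C.image (fun Y => insert g Y) ⊆ Uall.filter (fun W => g ∈ W ∧ f ∉ W) := by
    intro W hW
    rw [mem_image] at hW
    obtain ⟨Y, hY, rfl⟩ := hW
    rw [hC, mem_filter, mem_powersetCard] at hY
    obtain ⟨⟨hYH₀, hY4⟩, hYrk, hYc⟩ := hY
    have hfY : f ∉ Y := fun h => hfH₀ (hYH₀ h)
    have hgY : g ∉ Y := fun h => hgH₀ (hYH₀ h)
    have e1 : H \ insert g Y = insert f (H₀ \ Y) := by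
      ext a
      simp only [mem_sdiff, mem_insert, hmemH₀, not_or]
      constructor
      · rintro ⟨haH, hag, haY⟩
        by_cases haf : a = f
        · exact Or.inl haf
        · exact Or.inr ⟨⟨haH, haf, hag⟩, haY⟩
      · rintro (rfl | ⟨⟨haH, _, hag⟩, haY⟩)
        · exact ⟨hf, hfg, hfY⟩
        · exact ⟨haH, hag, haY⟩
    rw [mem_filter, hUall, mem_filter, mem_powersetCard]
    refine ⟨⟨⟨insert_subset hg (hYH₀.trans hH₀H), by rw [card_insert_of_notMem hgY, hY4]⟩, hYrk, ?_, Or.inr (mem_insert_self _ _)⟩,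
      mem_insert_self _ _, ?_⟩
    · rw [e1]
      exact hYc
    · rw [mem_insert, not_or]
      exact ⟨hfg, hfY⟩
  -- injectivity of the three maps
  have hAinj : Set.InjOn (fun Y => Y ∪ {f, g}) (A : Set (Finset α)) := by
    intro Y hY Y' hY' h
    rw [mem_coe, hA, mem_filter, mem_powersetCard] at hY hY'
    simp only at h
    have e1 : ∀ Z ⊆ H₀, (Z ∪ {f, g}) \ {f, g} = Z := by
      intro Z hZ
      ext a
      simp only [mem_sdiff, mem_union, mem_insert, mem_singleton, not_or]
      constructor
      · rintro ⟨h1, h2, h3⟩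
        exact h1.resolve_right (fun h => h.elim h2 h3)
      · intro haZ
        have := (hmemH₀ a).1 (hZ haZ)
        exact ⟨Or.inl haZ, this.2.1, this.2.2⟩
    rw [← e1 Y hY.1.1, ← e1 Y' hY'.1.1, h]
  have hBinj : Set.InjOn (fun Y => insert f Y) (B : Set (Finset α)) := by
    intro Y hY Y' hY' h
    rw [mem_coe, hB, mem_filter, mem_powersetCard] at hY hY'
    simp only at h
    have hfY : f ∉ Y := fun h' => hfH₀ (hY.1.1 h')
    have hfY' : f ∉ Y' := fun h' => hfH₀ (hY'.1.1 h')
    rw [← erase_insert hfY, ← erase_insert hfY', h]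
  have hCinj : Set.InjOn (fun Y => insert g Y) (C : Set (Finset α)) := by
    intro Y hY Y' hY' h
    rw [mem_coe, hC, mem_filter, mem_powersetCard] at hY hY'
    simp only at h
    have hgY : g ∉ Y := fun h' => hgH₀ (hY.1.1 h')
    have hgY' : g ∉ Y' := fun h' => hgH₀ (hY'.1.1 h')
    rw [← erase_insert hgY, ← erase_insert hgY', h]
  have h1 : A.card ≤ (Uall.filter (fun W => f ∈ W ∧ g ∈ W)).card := by
    rw [← card_image_of_injOn hAinj]; exact card_le_card hAimg
  have h2 : B.card ≤ (Uall.filter (fun W => f ∈ W ∧ g ∉ W)).card := by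
    rw [← card_image_of_injOn hBinj]; exact card_le_card hBimg
  have h3 : C.card ≤ (Uall.filter (fun W => g ∈ W ∧ f ∉ W)).card := by
    rw [← card_image_of_injOn hCinj]; exact card_le_card hCimg
  -- the three parts of `Uall` are disjoint
  have hd1 : Disjoint (Uall.filter (fun W => f ∈ W ∧ g ∈ W)) (Uall.filter (fun W => f ∈ W ∧ g ∉ W)) := by
    rw [disjoint_left]
    intro W hW hW'
    exact (mem_filter.1 hW').2.2 (mem_filter.1 hW).2.2
  have hd2 : Disjoint (Uall.filter (fun W => f ∈ W ∧ g ∈ W) ∪ Uall.filter (fun W => f ∈ W ∧ g ∉ W))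
      (Uall.filter (fun W => g ∈ W ∧ f ∉ W)) := by
    rw [disjoint_left]
    intro W hW hW'
    rw [mem_union, mem_filter, mem_filter] at hW
    rcases hW with h | h
    · exact (mem_filter.1 hW').2.2 h.2.1
    · exact (mem_filter.1 hW').2.2 h.2.1
  have h4 := card_le_card (show Uall.filter (fun W => f ∈ W ∧ g ∈ W) ∪ Uall.filter (fun W => f ∈ W ∧ g ∉ W) ∪
      Uall.filter (fun W => g ∈ W ∧ f ∉ W) ⊆ Uall from union_subset (union_subset (filter_subset _ _) (filter_subset _ _)) (filter_subset _ _))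
  rw [card_union_of_disjoint hd2, card_union_of_disjoint hd1] at h4
  omega

end TriangleUnits

end PercRepro.Cogirth
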